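import Summits.FinalStateConjecture.FinalStateConjecture.Theorems.ClusterCompletenessOmegaLimitMultiKerrVacuumOmegaLimits
import Summits.FinalStateConjecture.FinalStateConjecture.Theorems.ClusterCompletenessOmegaLimitMultiKerrRestAnchor
import Summits.FinalStateConjecture.FinalStateConjecture.Theorems.ClusterCompletenessOmegaLimitMultiKerrSharpMargin
import Summits.FinalStateConjecture.FinalStateConjecture.Theorems.ClusterCompletenessOmegaLimitMultiKerrAnchor
import Summits.FinalStateConjecture.FinalStateConjecture.Theorems.ClusterCompletenessOmegaLimitMultiKerrSmoothOmegaLimits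
import Summits.FinalStateConjecture.FinalStateConjecture.Theorems.EIHFluxBalanceInertialRecessionStubSlavingImmersion
import HarnessLib

/-!
# Crux `ClusterCompleteness.OmegaLimitMultiKerr` (stmt-FinalStateConjecture-14664), line `Sketch` —
# AT REST, smooth ω-limits of ANCHORED hole charts of a vacuum development are vacuum metrics on
# the whole exterior tube (the vacuum chain with no margin / immersion hypothesis left)

Structure lemmas (structure stub `ricAt_hole_omegaLimit_eq_zero_of_rest`, lead gen 4) for the crux
`OmegaLimitMultiKerr`. The vacuum chain `ricAt_hole_omegaLimit_eq_zero(_of_late)`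
(`…OmegaLimitMultiKerrVacuumOmegaLimits`) says: an ω-limit `g` of the deviation translates
`(Ψ^* 𝐠 − g_{M,a,Λ,c})(· + T n • Λ∂₀)` of a smooth hole chart `Ψ` of a VACUUM Cauchy development
defines a Ricci-flat chart metric `g + g_{M,a,Λ,c}` on a region `V` of the boosted exterior, PROVIDED
(i) `g + g_{M,a,Λ,c}` is a field of metric components on `V` (`MetricCoord.IsMetricOn`: smooth,
symmetric, invertible) and (ii) `Ψ` is an immersion on the late certified near zone
`{t* > τ₀, r ≤ R(t*)}`. Both were left as hypotheses because in general they need "nondegeneracy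
margin of the reference form `>` the `1/4` of the crux's anchor clause"
(`∀ τ > τ₀, truncDeviationCk B Ψ 0 (R τ) τ ≤ 1/4`, `R → ∞`). This file discharges BOTH from the
anchor clause wherever the margin beats `1/4` on the whole exterior, and records that AT REST
(`Λ = 1`, `c = 0`) this is automatic for `0 < M`, `a² < (224/225)M²` (sharp, `…SharpMargin`
p126356; in particular for `a² ≤ (8/9)M²`, `…RestAnchor` p124522):

* `eventually_norm_deviationExtend_translate_le_of_truncAnchor` — the anchor clause makes the
  translates `(Ψ^* 𝐠 − g_B)(x + sᵢ • Λ∂₀)`, `sᵢ → +∞`, eventually `1/4`-anchored in norm at every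
  exterior point `x` (`t*` is shifted by `sᵢ`, `r` is preserved —
  `KerrSchildChart.time_add_smul / radius_add_smul` —, `R(t*) ≥ r(x)` for late `t*`, and the
  pointwise pinching `norm_deviationExtend_le_of_truncAnchor` of `…OmegaLimitMultiKerrAnchor`): the
  hypothesis `hb` of `isMetricOn_hole_omegaLimit_add_boostedKerrBilin(_exterior_of_rest)`;
* `injective_mfderiv_of_truncAnchor_of_lt_margin` — margin ⇒ IMMERSION: on the late certified
  zone an anchored chart is an immersion at every point where the reference form has a margin
  `m > 1/4`, `m‖v‖ ≤ ‖g_B(x)(v, ·)‖` (`‖(Ψ^* 𝐠 − g_B)(x)‖ ≤ 1/4 < m` and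
  `SublinearIsFree.Slaving.injective_mfderiv_of_norm_deviation_lt`): hypothesis (ii);
* `isMetricOn_and_ricAt_hole_omegaLimit_eq_zero_of_truncAnchor` — the vacuum chain for a general
  motion `(Λ, c)` under the single hypothesis "a margin function `m > 1/4` on the whole boosted
  exterior": margin ⇒ `IsMetricOn` on the exterior (`isMetricOn_hole_omegaLimit_add_boostedKerrBilin`
  of `…LimitIsMetric`, hypothesis (i)) and margin ⇒ immersion, fed into
  `ricAt_hole_omegaLimit_eq_zero_of_late` with `V` the whole exterior;
* AT REST the margin hypothesis disappears: `kerrMargin_mul_norm_le_norm_boostedKerrBilin_one_zero`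
  / `quarter_lt_kerrMargin` (`…SharpMargin`: the exact margin `√(1 + (2H)²) − 2H > 1/4` on the
  exterior for `a² < (224/225)M²`), whence `injective_mfderiv_of_truncAnchor_of_rest`,
  `isMetricOn_hole_omegaLimit_of_truncAnchor_of_rest` and the MAIN theorem
  `ricAt_hole_omegaLimit_eq_zero_of_rest` (registered, closed form): **at rest, every smooth
  ω-limit `g` of an anchored hole chart of a vacuum development gives a Ricci-flat field of metric
  components `g + g_{M,a}` on the WHOLE exterior tube** — no margin, no immersion hypothesis;
  `ricAt_hole_omegaLimit_eq_zero_of_rest_of_sq_le` is the same on `…RestAnchor`'s range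
  `a² ≤ (8/9)M²` (margin `(1 + 4|H|)⁻¹ > 1/4`, `inv_mul_norm_le_norm_boostedKerrBilin_one_zero`,
  `quarter_lt_inv_one_add_four_mul_abs_scalarH`);
* `exists_smoothOmegaLimit_ricAt_eq_zero_of_rest` — packaged with the EXISTENCE of smooth ω-limits
  for hole charts tame at every order (`exists_smoothOmegaLimit_hole_translate`,
  `…SmoothOmegaLimits`): along a subsequence of any `T n → +∞` there is a smooth ω-limit `g`, and
  `g + g_{M,a}` is a Ricci-flat field of metric components on the exterior.

For BOOSTED or near-extremal holes the absolute `1/4` anchor may be idle (`…AnchorMargin` p124691,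
`exists_norm_kerrBilin_lt_quarter_mul_norm` in `…SharpMargin` p126356); there the statement needs the
recurrence instants or a frame-relative anchor, which is why the general form keeps the margin
function as a hypothesis. Everything is proved; Mathlib + landed `Literature` / `Theorems` files
only, no definitions.

## References
* P. Petersen, *Riemannian Geometry*, 2nd ed., GTM 171, Springer 2006, Ch. 10, §3.2 (curvature
  under `C²` convergence of metrics). [Petersen2006]
* B. O'Neill, *Semi-Riemannian geometry*, Academic Press 1983, Ch. 3, Def. 3.1, Lemma 3.4,
  Prop. 3.59. [ONeill1983]
* R. P. Kerr, A. Schild, *A new class of vacuum solutions of the Einstein field equations*, 1965,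
  §2. [KerrSchild1965]
* J. K. Hale, *Ordinary differential equations*, 2nd ed., Krieger 1980, Ch. I, §8 (ω-limit sets).
  [Hale1980]
-/

-- every `Summit.FinalStateConjecture.FinalStateConjecture.…` name repeats the summit = sub-problem segment (D-0017 layout)
set_option linter.dupNamespace false
-- the normed-group instances on `E4 →L[ℝ] E4 →L[ℝ] ℝ` need one more level of pending instance
-- problems than the default (as in `CoordCurvature.lean`)
set_option maxSynthPendingDepth 3

noncomputable section

open scoped Manifold ContDiff Topology ENNReal
open Set Filter TopologicalSpace

namespace Summit.FinalStateConjecture.FinalStateConjecture.Theorems.ClusterCompleteness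

open Literature.Geometry.Lorentzian

/-! ### From the anchor clause: eventual anchoring of the translates, immersion from a margin -/

section Anchor

/-- **The anchor clause anchors the late translates at every exterior point.** For a hole chart `Ψ`
on `B = boostedKerrBackground Λ c M a` with the crux's anchor clause
`∀ τ > τ₀, truncDeviationCk B Ψ 0 (R τ) τ ≤ 1/4`, `R → ∞`, and translation parameters `sᵢ → +∞`,
at every point `x` of the boosted exterior eventually `‖(Ψ^* 𝐠 − g_B)(x + sᵢ • Λ∂₀)‖ ≤ 1/4`: the
translate has rest-frame time `t*(x) + sᵢ` and radius `r(x)`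
(`KerrSchildChart.time_add_smul / radius_add_smul`), so it is late and certified
(`r(x) ≤ R(t*(x) + sᵢ)`) for large `i`, where the truncated anchor pinches the deviation pointwise
(`norm_deviationExtend_le_of_truncAnchor`). This is the hypothesis `hb` of
`isMetricOn_hole_omegaLimit_add_boostedKerrBilin` (Hale 1980, Ch. I, §8: ω-limit sets inherit the
closed constraint). [folklore] -/
theorem eventually_norm_deviationExtend_translate_le_of_truncAnchor (Λ : lorentzGroup) (c : E4)
    (M a : ℝ) (𝓢 : Spacetime 4) (Ψ : (boostedKerrBackground Λ c M a).domain → 𝓢.carrier)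
    {τ₀ : ℝ} {R : ℝ → ℝ} (hR : Tendsto R atTop atTop)
    (h : ∀ τ : ℝ, τ₀ < τ →
      𝓢.truncDeviationCk (boostedKerrBackground Λ c M a) Ψ 0 (R τ) τ ≤ ENNReal.ofReal (1 / 4))
    {ι : Type*} {l : Filter ι} {s : ι → ℝ} (hs : Tendsto s l atTop) {x : E4}
    (hx : x ∈ (boostedKerrExterior Λ c M a : Set E4)) :
    ∀ᶠ i in l, ‖𝓢.deviationExtend (boostedKerrBackground Λ c M a) Ψ
      (x + s i • (Λ : E4 ≃L[ℝ] E4) (EuclideanSpace.single (0 : Fin 4) (1 : ℝ)))‖ ≤ 1 / 4 := by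
  -- eventually `R ≥ r(x)`, and eventually the translates are that late
  obtain ⟨τ₁, hτ₁⟩ := eventually_atTop.1
    (hR.eventually_ge_atTop ((boostedKerrBackground Λ c M a).radius x))
  filter_upwards [hs.eventually_ge_atTop
    (max τ₀ τ₁ - (boostedKerrBackground Λ c M a).time x + 1)] with i hi
  have hxs := add_smul_mem_boostedKerrBackground_domain Λ c M a x hx (s i)
  have hlate : τ₀ < (boostedKerrBackground Λ c M a).time
      (x + s i • (Λ : E4 ≃L[ℝ] E4) (EuclideanSpace.single (0 : Fin 4) (1 : ℝ))) := by
    rw [KerrSchildChart.time_add_smul]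
    linarith [le_max_left τ₀ τ₁]
  have hzone : (boostedKerrBackground Λ c M a).radius
      (x + s i • (Λ : E4 ≃L[ℝ] E4) (EuclideanSpace.single (0 : Fin 4) (1 : ℝ))) ≤
      R ((boostedKerrBackground Λ c M a).time
        (x + s i • (Λ : E4 ≃L[ℝ] E4) (EuclideanSpace.single (0 : Fin 4) (1 : ℝ)))) := by
    rw [KerrSchildChart.time_add_smul, KerrSchildChart.radius_add_smul]
    exact hτ₁ _ (by linarith [le_max_right τ₀ τ₁])
  exact norm_deviationExtend_le_of_truncAnchor h ⟨_, hxs⟩ hlate hzone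

/-- **Margin above the anchor ⇒ immersion on the certified zone.** For a chart `Ψ` on a general
background `B` with the anchor clause `∀ τ > τ₀, truncDeviationCk B Ψ 0 (R τ) τ ≤ 1/4`, at every
point `z` of the late certified near zone (`t(z) > τ₀`, `r(z) ≤ R(t(z))`) where the reference form
has a margin `m > 1/4`, `m‖v‖ ≤ ‖g_B(z)(v, ·)‖`, the differential `dΨ_z` is injective:
`‖(Ψ^* 𝐠 − g_B)(z)‖ ≤ 1/4 < m` (`norm_deviationExtend_le_of_truncAnchor`), and a kernel vector `v`
of `dΨ_z` would have `‖g_B(z)(v, ·)‖ = ‖(Ψ^* 𝐠 − g_B)(z)(v, ·)‖ < m‖v‖`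
(`SublinearIsFree.Slaving.injective_mfderiv_of_norm_deviation_lt`). [folklore] -/
theorem injective_mfderiv_of_truncAnchor_of_lt_margin (𝓢 : Spacetime 4) {B : ModelBackground}
    (Ψ : B.domain → 𝓢.carrier) {τ₀ : ℝ} {R : ℝ → ℝ}
    (h : ∀ τ : ℝ, τ₀ < τ → 𝓢.truncDeviationCk B Ψ 0 (R τ) τ ≤ ENNReal.ofReal (1 / 4))
    (z : B.domain) (hz : τ₀ < B.time z.1) (hRz : B.radius z.1 ≤ R (B.time z.1)) {m : ℝ}
    (hm : ∀ v : E4, m * ‖v‖ ≤ ‖B.bilin z.1 v‖) (hq : 1 / 4 < m) :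
    Function.Injective (mfderiv 𝓘(ℝ, E4) (𝓡 4) Ψ z) := by
  refine SublinearIsFree.Slaving.injective_mfderiv_of_norm_deviation_lt 𝓢 B Ψ z hm ?_
  have h' := norm_deviationExtend_le_of_truncAnchor h z hz hRz
  rw [Spacetime.deviationExtend_coe] at h'
  exact h'.trans_lt hq

/-- **The exact at-rest margin in the crux's boosted vocabulary**: for `0 ≤ M` and
`x ∈ boostedKerrExterior 1 0 M a` (`= Kerr.exterior M a`),
`(√(1 + (2H(x))²) − 2H(x))‖v‖ ≤ ‖boostedKerrBilin 1 0 M a x (v, ·)‖`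
(`mul_norm_le_norm_kerrBilin` through `boostedKerrBilin_one_zero`; Kerr–Schild 1965, §2,
`g = η + 2Hℓ ⊗ ℓ` with `ℓ` null). [cite: KerrSchild1965, §2] -/
theorem kerrMargin_mul_norm_le_norm_boostedKerrBilin_one_zero {M : ℝ} (hM : 0 ≤ M) (a : ℝ)
    {x : E4} (hx : x ∈ (boostedKerrExterior 1 0 M a : Set E4)) (v : E4) :
    (√(1 + (2 * Kerr.scalarH M a x) ^ 2) - 2 * Kerr.scalarH M a x) * ‖v‖ ≤
      ‖boostedKerrBilin 1 0 M a x v‖ := by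
  rw [boostedKerrBilin_one_zero]
  exact mul_norm_le_norm_kerrBilin hM
    (Kerr.radius_pos_of_mem_region (mem_exterior_of_mem_boostedKerrExterior_one_zero hx)) v

/-- **At rest, anchored hole charts are immersions on the whole late certified zone**: for
`0 < M`, `a² < (224/225)M²` and a chart `Ψ` on `boostedKerrBackground 1 0 M a` with the anchor
clause, `dΨ_z` is injective at every `z` with `t*(z) > τ₀`, `r(z) ≤ R(t*(z))`
(`injective_mfderiv_of_truncAnchor_of_lt_margin` with the exact margin
`√(1 + (2H)²) − 2H > 1/4`, `quarter_lt_kerrMargin`) — hypothesis `hinj` of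
`ricAt_hole_omegaLimit_eq_zero_of_late`, discharged. [folklore] -/
theorem injective_mfderiv_of_truncAnchor_of_rest {M a : ℝ} (hM : 0 < M)
    (ha : a ^ 2 < 224 / 225 * M ^ 2) (𝓢 : Spacetime 4)
    (Ψ : (boostedKerrBackground 1 0 M a).domain → 𝓢.carrier) {τ₀ : ℝ} {R : ℝ → ℝ}
    (h : ∀ τ : ℝ, τ₀ < τ →
      𝓢.truncDeviationCk (boostedKerrBackground 1 0 M a) Ψ 0 (R τ) τ ≤ ENNReal.ofReal (1 / 4))
    (z : (boostedKerrBackground 1 0 M a).domain)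
    (hz : τ₀ < (boostedKerrBackground 1 0 M a).time z.1)
    (hRz : (boostedKerrBackground 1 0 M a).radius z.1 ≤
      R ((boostedKerrBackground 1 0 M a).time z.1)) :
    Function.Injective (mfderiv 𝓘(ℝ, E4) (𝓡 4) Ψ z) :=
  injective_mfderiv_of_truncAnchor_of_lt_margin 𝓢 Ψ h z hz hRz
    (kerrMargin_mul_norm_le_norm_boostedKerrBilin_one_zero hM.le a z.2)
    (quarter_lt_kerrMargin hM ha (mem_exterior_of_mem_boostedKerrExterior_one_zero z.2))

end Anchor

/-! ### The vacuum chain without margin / immersion hypotheses -/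

section Vacuum

variable {X : Type} [TopologicalSpace X] [ChartedSpace E3 X] [IsManifold (𝓡 3) ∞ X]
  [ConnectedSpace X] {D : InitialDataSet (𝓡 3) X}

/-- **The vacuum chain under a margin function (general motion).** Let `𝒟` be a VACUUM Cauchy
development, `Ψ` a smooth hole chart on `B = boostedKerrBackground Λ c M a` with the crux's anchor
clause `∀ τ > τ₀, truncDeviationCk B Ψ 0 (R τ) τ ≤ 1/4`, `R → ∞`, and suppose the reference form
has a margin `m(x) > 1/4`, `m(x)‖v‖ ≤ ‖g_{M,a,Λ,c}(x)(v, ·)‖`, at EVERY point of the boosted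
exterior. Let `g` be a smooth ω-limit of the deviation translates along chart times `T n → +∞`
(`supCkENorm K k ((Ψ^* 𝐠 − g_B)(· + T n • Λ∂₀) − g) → 0` on every compact `K` of the exterior,
`k ≥ 2`). Then `g + g_{M,a,Λ,c}` is a field of metric components on the whole exterior
(`isMetricOn_hole_omegaLimit_add_boostedKerrBilin`, the translates being eventually anchored by
`eventually_norm_deviationExtend_translate_le_of_truncAnchor`) AND it is Ricci-flat there
(`ricAt_hole_omegaLimit_eq_zero_of_late` with `V` the exterior, the immersion hypothesis being
`injective_mfderiv_of_truncAnchor_of_lt_margin`): both remaining hypotheses of the vacuum chain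
follow from "margin `>` anchor" (Petersen 2006, Ch. 10, §3.2; O'Neill 1983, Ch. 3, Lemma 3.4).
[cite: Petersen2006, Ch. 10 §3.2] -/
theorem isMetricOn_and_ricAt_hole_omegaLimit_eq_zero_of_truncAnchor
    (𝒟 : VacuumCauchyDevelopment D) (Λ : lorentzGroup) (c : E4) (M a : ℝ)
    {Ψ : (boostedKerrBackground Λ c M a).domain → 𝒟.carrier}
    (hΨ : ContMDiff 𝓘(ℝ, E4) (𝓡 4) ∞ Ψ) {τ₀ : ℝ} {R : ℝ → ℝ} (hR : Tendsto R atTop atTop)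
    (h : ∀ τ : ℝ, τ₀ < τ → 𝒟.toSpacetime.truncDeviationCk (boostedKerrBackground Λ c M a) Ψ 0
      (R τ) τ ≤ ENNReal.ofReal (1 / 4))
    {m : E4 → ℝ}
    (hm : ∀ x ∈ (boostedKerrExterior Λ c M a : Set E4), ∀ v : E4,
      m x * ‖v‖ ≤ ‖boostedKerrBilin Λ c M a x v‖)
    (hc : ∀ x ∈ (boostedKerrExterior Λ c M a : Set E4), 1 / 4 < m x)
    {k : ℕ} (hk : 2 ≤ k) {g : E4 → E4 →L[ℝ] E4 →L[ℝ] ℝ}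
    (hg : ContDiffOn ℝ ∞ g (boostedKerrExterior Λ c M a : Set E4))
    {T : ℕ → ℝ} (hT : Tendsto T atTop atTop)
    (hlim : ∀ K ⊆ (boostedKerrExterior Λ c M a : Set E4), IsCompact K →
      Tendsto (fun n ↦ supCkENorm K k (fun x ↦
        𝒟.toSpacetime.deviationExtend (boostedKerrBackground Λ c M a) Ψ
          (x + T n • (Λ : E4 ≃L[ℝ] E4) (EuclideanSpace.single (0 : Fin 4) (1 : ℝ))) - g x))
        atTop (𝓝 0)) :
    MetricCoord.IsMetricOn (fun x ↦ g x + boostedKerrBilin Λ c M a x)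
        (boostedKerrExterior Λ c M a : Set E4) ∧
      ∀ x ∈ (boostedKerrExterior Λ c M a : Set E4),
        MetricCoord.ricAt (fun x ↦ g x + boostedKerrBilin Λ c M a x) x = 0 := by
  have hG : MetricCoord.IsMetricOn (fun x ↦ g x + boostedKerrBilin Λ c M a x)
      (boostedKerrExterior Λ c M a : Set E4) :=
    isMetricOn_hole_omegaLimit_add_boostedKerrBilin Λ c M a 𝒟.toSpacetime Ψ hg
      (boostedKerrExterior Λ c M a).isOpen subset_rfl hlim
      (fun _ hx ↦ eventually_norm_deviationExtend_translate_le_of_truncAnchor Λ c M a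
        𝒟.toSpacetime Ψ hR h hT hx) hm hc
  exact ⟨hG, ricAt_hole_omegaLimit_eq_zero_of_late 𝒟 Λ c M a hΨ hR
    (fun z hz hRz ↦ injective_mfderiv_of_truncAnchor_of_lt_margin 𝒟.toSpacetime Ψ h z hz hRz
      (hm z.1 z.2) (hc z.1 z.2)) hk subset_rfl hG hT hlim⟩

/-- **At rest, anchored smooth ω-limits are metrics on the whole exterior** (the anchor-clause form
of `isMetricOn_hole_omegaLimit_add_boostedKerrBilin_exterior_of_rest`): for `0 < M`,
`a² < (224/225)M²`, a hole chart `Ψ` on `boostedKerrBackground 1 0 M a` with the crux's anchor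
clause (`R → ∞`), chart times `T n → +∞` and a smooth ω-limit `g` of the deviation translates (any
order `k`), `g + g_{M,a}` is a field of metric components on `boostedKerrExterior 1 0 M a`
(`isMetricOn_hole_omegaLimit_add_boostedKerrBilin` with the exact margin `√(1 + (2H)²) − 2H > 1/4`
and the eventual anchoring `eventually_norm_deviationExtend_translate_le_of_truncAnchor`; O'Neill
1983, Ch. 3, Def. 3.1). [cite: ONeill1983, Ch. 3 Def. 3.1] -/
theorem isMetricOn_hole_omegaLimit_of_truncAnchor_of_rest {M a : ℝ} (hM : 0 < M)
    (ha : a ^ 2 < 224 / 225 * M ^ 2) (𝓢 : Spacetime 4)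
    {Ψ : (boostedKerrBackground 1 0 M a).domain → 𝓢.carrier} {τ₀ : ℝ} {R : ℝ → ℝ}
    (hR : Tendsto R atTop atTop)
    (h : ∀ τ : ℝ, τ₀ < τ →
      𝓢.truncDeviationCk (boostedKerrBackground 1 0 M a) Ψ 0 (R τ) τ ≤ ENNReal.ofReal (1 / 4))
    {g : E4 → E4 →L[ℝ] E4 →L[ℝ] ℝ} (hg : ContDiffOn ℝ ∞ g (boostedKerrExterior 1 0 M a : Set E4))
    {k : ℕ} {T : ℕ → ℝ} (hT : Tendsto T atTop atTop)
    (hlim : ∀ K ⊆ (boostedKerrExterior 1 0 M a : Set E4), IsCompact K →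
      Tendsto (fun n ↦ supCkENorm K k (fun x ↦
        𝓢.deviationExtend (boostedKerrBackground 1 0 M a) Ψ
          (x + T n • ((1 : lorentzGroup) : E4 ≃L[ℝ] E4)
            (EuclideanSpace.single (0 : Fin 4) (1 : ℝ))) - g x)) atTop (𝓝 0)) :
    MetricCoord.IsMetricOn (fun x ↦ g x + boostedKerrBilin 1 0 M a x)
      (boostedKerrExterior 1 0 M a : Set E4) :=
  isMetricOn_hole_omegaLimit_add_boostedKerrBilin 1 0 M a 𝓢 Ψ hg
    (boostedKerrExterior 1 0 M a).isOpen subset_rfl hlim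
    (fun _ hx ↦ eventually_norm_deviationExtend_translate_le_of_truncAnchor 1 0 M a 𝓢 Ψ hR h hT
      hx)
    (fun _ hx ↦ kerrMargin_mul_norm_le_norm_boostedKerrBilin_one_zero hM.le a hx)
    (fun _ hx ↦ quarter_lt_kerrMargin hM ha (mem_exterior_of_mem_boostedKerrExterior_one_zero hx))

/-- **AT REST, smooth ω-limits of anchored hole charts of a VACUUM development are vacuum on the
whole exterior tube** (registered structure stub of line `Sketch`, crux
stmt-FinalStateConjecture-14664, closed form). Let `𝒟` be a vacuum Cauchy development, `0 < M`,
`a² < (224/225)M²` (`|a| < 0.9978M`; covers `a² ≤ (8/9)M²`), `Ψ` a smooth hole chart AT REST,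
on `boostedKerrBackground 1 0 M a`, satisfying the crux's anchor clause
`∀ τ > τ₀, truncDeviationCk (boostedKerrBackground 1 0 M a) Ψ 0 (R τ) τ ≤ 1/4` with `R → ∞`,
`k ≥ 2`, `T n → +∞` chart times, and `g` a smooth (`C^∞` on the exterior) ω-limit of the deviation
translates: `supCkENorm K k ((Ψ^* 𝐠 − g_{M,a})(· + T n • ∂₀) − g) → 0` on every compact `K` of the
exterior (verbatim the output of `exists_(smooth)omegaLimit_hole_translate` at `Λ = 1`). Then
`Ric[g + g_{M,a}] = 0` at every point of `boostedKerrExterior 1 0 M a`: the vacuum chain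
`ricAt_hole_omegaLimit_eq_zero_of_late` with BOTH its remaining hypotheses discharged at rest —
margin ⇒ `IsMetricOn` (`isMetricOn_hole_omegaLimit_of_truncAnchor_of_rest`, cf. `…RestAnchor`) and
margin ⇒ immersion on the certified zone (`injective_mfderiv_of_truncAnchor_of_rest`), the exact
at-rest margin `√(1 + (2H)²) − 2H` beating the `1/4` anchor on the whole exterior
(`quarter_lt_kerrMargin`). For boosted or near-extremal holes the anchor may be idle and the
statement needs the recurrence instants or a frame-relative anchor (`…AnchorMargin`,
`…SharpMargin`). Petersen 2006, Ch. 10, §3.2; O'Neill 1983, Ch. 3, Lemma 3.4 and Prop. 3.59.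
[cite: Petersen2006, Ch. 10 §3.2] -/
theorem ricAt_hole_omegaLimit_eq_zero_of_rest : ∀ {X : Type} [TopologicalSpace X] [ChartedSpace E3 X] [IsManifold (𝓡 3) ∞ X] [ConnectedSpace X] {D : InitialDataSet (𝓡 3) X} (𝒟 : VacuumCauchyDevelopment D) {M a : ℝ}, 0 < M → a ^ 2 < 224 / 225 * M ^ 2 → ∀ (Ψ : (boostedKerrBackground 1 0 M a).domain → 𝒟.carrier), ContMDiff 𝓘(ℝ, E4) (𝓡 4) ∞ Ψ → ∀ {τ₀ : ℝ} {R : ℝ → ℝ}, Tendsto R atTop atTop → (∀ τ : ℝ, τ₀ < τ → 𝒟.toSpacetime.truncDeviationCk (boostedKerrBackground 1 0 M a) Ψ 0 (R τ) τ ≤ ENNReal.ofReal (1 / 4)) → ∀ {k : ℕ}, 2 ≤ k → ∀ {g : E4 → E4 →L[ℝ] E4 →L[ℝ] ℝ}, ContDiffOn ℝ ∞ g (boostedKerrExterior 1 0 M a : Set E4) → ∀ {T : ℕ → ℝ}, Tendsto T atTop atTop → (∀ K ⊆ (boostedKerrExterior 1 0 M a : Set E4), IsCompact K → Tendsto (fun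 n ↦ supCkENorm K k (fun x ↦ 𝒟.toSpacetime.deviationExtend (boostedKerrBackground 1 0 M a) Ψ (x + T n • ((1 : lorentzGroup) : E4 ≃L[ℝ] E4) (EuclideanSpace.single (0 : Fin 4) (1 : ℝ))) - g x)) atTop (𝓝 0)) → ∀ x ∈ (boostedKerrExterior 1 0 M a : Set E4), MetricCoord.ricAt (fun x ↦ g x + boostedKerrBilin 1 0 M a x) x = 0 := by
  intro X _ _ _ _ D 𝒟 M a hM ha Ψ hΨ τ₀ R hR h k hk g hg T hT hlim
  exact (isMetricOn_and_ricAt_hole_omegaLimit_eq_zero_of_truncAnchor 𝒟 1 0 M a hΨ hR h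
    (fun _ hx ↦ kerrMargin_mul_norm_le_norm_boostedKerrBilin_one_zero hM.le a hx)
    (fun _ hx ↦ quarter_lt_kerrMargin hM ha (mem_exterior_of_mem_boostedKerrExterior_one_zero hx))
    hk hg hT hlim).2

/-- **The same on `…RestAnchor`'s range `a² ≤ (8/9)M²`** (which covers `a = 0.9M`): there the
crude margin `(1 + 4|H(x)|)⁻¹` already beats `1/4` on the whole exterior
(`inv_mul_norm_le_norm_boostedKerrBilin_one_zero`, `quarter_lt_inv_one_add_four_mul_abs_scalarH`),
and `isMetricOn_and_ricAt_hole_omegaLimit_eq_zero_of_truncAnchor` applies verbatim: at rest with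
`a² ≤ (8/9)M²`, smooth ω-limits of anchored hole charts of a vacuum development are Ricci-flat on the
whole exterior (Petersen 2006, Ch. 10, §3.2). [cite: Petersen2006, Ch. 10 §3.2] -/
theorem ricAt_hole_omegaLimit_eq_zero_of_rest_of_sq_le (𝒟 : VacuumCauchyDevelopment D) {M a : ℝ}
    (hM : 0 < M) (ha : a ^ 2 ≤ 8 / 9 * M ^ 2)
    {Ψ : (boostedKerrBackground 1 0 M a).domain → 𝒟.carrier}
    (hΨ : ContMDiff 𝓘(ℝ, E4) (𝓡 4) ∞ Ψ) {τ₀ : ℝ} {R : ℝ → ℝ} (hR : Tendsto R atTop atTop)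
    (h : ∀ τ : ℝ, τ₀ < τ → 𝒟.toSpacetime.truncDeviationCk (boostedKerrBackground 1 0 M a) Ψ 0
      (R τ) τ ≤ ENNReal.ofReal (1 / 4))
    {k : ℕ} (hk : 2 ≤ k) {g : E4 → E4 →L[ℝ] E4 →L[ℝ] ℝ}
    (hg : ContDiffOn ℝ ∞ g (boostedKerrExterior 1 0 M a : Set E4))
    {T : ℕ → ℝ} (hT : Tendsto T atTop atTop)
    (hlim : ∀ K ⊆ (boostedKerrExterior 1 0 M a : Set E4), IsCompact K →
      Tendsto (fun n ↦ supCkENorm K k (fun x ↦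
        𝒟.toSpacetime.deviationExtend (boostedKerrBackground 1 0 M a) Ψ
          (x + T n • ((1 : lorentzGroup) : E4 ≃L[ℝ] E4)
            (EuclideanSpace.single (0 : Fin 4) (1 : ℝ))) - g x)) atTop (𝓝 0)) :
    MetricCoord.IsMetricOn (fun x ↦ g x + boostedKerrBilin 1 0 M a x)
        (boostedKerrExterior 1 0 M a : Set E4) ∧
      ∀ x ∈ (boostedKerrExterior 1 0 M a : Set E4),
        MetricCoord.ricAt (fun x ↦ g x + boostedKerrBilin 1 0 M a x) x = 0 :=
  isMetricOn_and_ricAt_hole_omegaLimit_eq_zero_of_truncAnchor 𝒟 1 0 M a hΨ hR h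
    (fun _ hx ↦ inv_mul_norm_le_norm_boostedKerrBilin_one_zero M a hx)
    (fun _ hx ↦ quarter_lt_inv_one_add_four_mul_abs_scalarH hM ha hx) hk hg hT hlim

/-- **Existence packaged: at rest, tame anchored hole charts of a vacuum development have vacuum
ω-limits.** Let `𝒟` be a vacuum Cauchy development, `0 < M`, `a² < (224/225)M²`, `Ψ` a smooth hole
chart on `boostedKerrBackground 1 0 M a` with the crux's anchor clause (`R → ∞`) whose deviation has
finite `Cᵏ` sup norm over every truncated late region `{t* > τ₁, r ≤ R'}` for EVERY `k` (tameness at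
all orders), and `T n → +∞`. Then along a subsequence `φ` there is a field `g`, `C^∞` on the
exterior, to which the deviation translates converge in every `Cᵏ` on every compact of the exterior
(`exists_smoothOmegaLimit_hole_translate`, Arzelà–Ascoli at all orders), and the limit chart metric
`g + g_{M,a}` is a field of metric components, Ricci-flat, on the whole exterior tube
(`isMetricOn_and_ricAt_hole_omegaLimit_eq_zero_of_truncAnchor` at order `2` along `T ∘ φ → +∞`).
Petersen 2006, Ch. 10, §3.1–§3.2; Hale 1980, Ch. I, §8. [cite: Petersen2006, Ch. 10 §3.2] -/
theorem exists_smoothOmegaLimit_ricAt_eq_zero_of_rest (𝒟 : VacuumCauchyDevelopment D) {M a : ℝ}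
    (hM : 0 < M) (ha : a ^ 2 < 224 / 225 * M ^ 2)
    {Ψ : (boostedKerrBackground 1 0 M a).domain → 𝒟.carrier}
    (hΨ : ContMDiff 𝓘(ℝ, E4) (𝓡 4) ∞ Ψ) {τ₀ : ℝ} {R : ℝ → ℝ} (hR : Tendsto R atTop atTop)
    (h : ∀ τ : ℝ, τ₀ < τ → 𝒟.toSpacetime.truncDeviationCk (boostedKerrBackground 1 0 M a) Ψ 0
      (R τ) τ ≤ ENNReal.ofReal (1 / 4))
    {τ₁ : ℝ}
    (hfin : ∀ (k : ℕ) (R' : ℝ),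
      supCkENorm (Subtype.val '' (boostedKerrBackground 1 0 M a).truncLateRegion τ₁ R') k
        (𝒟.toSpacetime.deviationExtend (boostedKerrBackground 1 0 M a) Ψ) ≠ ⊤)
    {T : ℕ → ℝ} (hT : Tendsto T atTop atTop) :
    ∃ (g : E4 → E4 →L[ℝ] E4 →L[ℝ] ℝ) (φ : ℕ → ℕ), StrictMono φ ∧
      ContDiffOn ℝ ∞ g (boostedKerrExterior 1 0 M a : Set E4) ∧
      (∀ (k : ℕ), ∀ K ⊆ (boostedKerrExterior 1 0 M a : Set E4), IsCompact K →
        Tendsto (fun n ↦ supCkENorm K k (fun x ↦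
          𝒟.toSpacetime.deviationExtend (boostedKerrBackground 1 0 M a) Ψ
            (x + T (φ n) • ((1 : lorentzGroup) : E4 ≃L[ℝ] E4)
              (EuclideanSpace.single (0 : Fin 4) (1 : ℝ))) - g x)) atTop (𝓝 0)) ∧
      MetricCoord.IsMetricOn (fun x ↦ g x + boostedKerrBilin 1 0 M a x)
        (boostedKerrExterior 1 0 M a : Set E4) ∧
      ∀ x ∈ (boostedKerrExterior 1 0 M a : Set E4),
        MetricCoord.ricAt (fun x ↦ g x + boostedKerrBilin 1 0 M a x) x = 0 := by
  obtain ⟨g, φ, hφ, hg, hlim⟩ :=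
    exists_smoothOmegaLimit_hole_translate 𝒟.toSpacetime 1 0 M a hΨ hfin hT
  have hTφ : Tendsto (fun n ↦ T (φ n)) atTop atTop := hT.comp hφ.tendsto_atTop
  obtain ⟨hG, hric⟩ := isMetricOn_and_ricAt_hole_omegaLimit_eq_zero_of_truncAnchor 𝒟 1 0 M a hΨ
    hR h (fun _ hx ↦ kerrMargin_mul_norm_le_norm_boostedKerrBilin_one_zero hM.le a hx)
    (fun _ hx ↦ quarter_lt_kerrMargin hM ha (mem_exterior_of_mem_boostedKerrExterior_one_zero hx))
    le_rfl hg hTφ (hlim 2)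
  exact ⟨g, φ, hφ, hg, hlim, hG, hric⟩

end Vacuum

end Summit.FinalStateConjecture.FinalStateConjecture.Theorems.ClusterCompleteness

end
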